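import Summits.QuantumFields.YangMills.Theorems.UnitScaleTiltProp7CovKernelTowerAssembly
import Summits.QuantumFields.YangMills.Theorems.UnitScaleTiltProp7CovLogTowerOfRegPrT3
import Summits.QuantumFields.YangMills.Theorems.UnitScaleTiltProp7CcolOf157EntryT3
import Summits.QuantumFields.YangMills.Theorems.UnitScaleTiltProp7TwistedOneStepDefectOfRegPr
import Literature.MathematicalPhysics.QuantumFieldTheory.Balaban1983to89.B7Prop4GeneralInduction
import HarnessLib

/-!
# Route `UnitScaleTilt`, crux K1 «MinimiserStabilityRegPr» (stmt-QuantumFields-19200), EX display row (157)-twˢ `hC157`, C-ENTRY line, file F-5a —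
# **[Balaban1985Averaging] PROP. 5 (157) FOR THE SYMMETRIC TWISTED CHART AT A PRINTED-REGULAR BACKGROUND, AT THE MEMBER**:
# `‖(∂C^{twS}(U₀)∕∂B)(B)[δ](c)‖ ≤ 10¹¹L⁵·(L^{K−n})⁻¹·‖B‖·‖δ‖` for `U₀ ∈ 𝔘_k(ε₀)`, `‖B‖ < e·η`, a single-bond direction `δ`, under the L-only windows
# `10⁹L²e ≤ 1`, `10¹²L³ε₀ ≤ 1` (chart) and `10¹¹L⁶e ≤ 1`, `10¹⁶L⁵ε₀ ≤ 1` (kernel tower, Cauchy route)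

Cell `ym3-torus` (HUMAN RULING D-0037: YM₃ on T³ is ladder rung R3, not the Clay problem), width seat `ym3-torus-px18` gen 3; ★w2-19200 g8 «C-ENTRY GO».  `--supports
stmt-QuantumFields-19200 --as helper`; def-free, 0 sorry; count-neutral.

HOW.  `C^{twS}(U₀)(X)(c) = (F_J X − Lin_J X)(ĉ)` on the ball `‖X‖ < e·η` (✓`Prop7CovLogTower.CmapTwS_apply_eq_iterate_sub_lin`, windows ✓`Prop7CovLogTowerOfRegPr.hwinr_of_regPr`∕
`differentiableAt_phiCov_zero_of_regPr`), so `fderiv C^{twS}(B)[δ](c)` is the `t`-derivative of `(F_J − Lin_J)(B + tδ)(ĉ)` at `0` (✓`Prop7CcolOf157Entry.differentiableAt_CmapTwS`, chain rule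
along the complex line, uniqueness of derivatives) = the kernel `vd(ĉ) − (Lin_J δ)(ĉ)` of F-4b ✓`Prop7CovKernelTowerAssembly.hasDerivAt_iterate_kernel_bound_of_plaqSmall`, whose budgets
at the member are ★px15 g3's ✓`Prop7TwistedOneStepDefectOfRegPr.member_rows` (`RegPr ⇒ PlaqSmall (ε₀L^{−2(K−n)})`, `R = (30000L)⁻¹`, `Lˡs_B ≤ 18ε₀∕L`) plus `ρ := (10⁷ℓ²)⁻¹` and the
L-only numerals of §1 (`s₀(l) ≤ 2700ε₀`, `c_R(l) ≤ 2592·10¹¹L³ε₀`, geometric level sums).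
* §1 real-number lemmas; §2 `member_kernel_rows` (every budget∕window of F-4b at the member); §3 ★★★ `norm_fderiv_CmapTwS_apply_le_of_regPr` (the title).
HONEST SCOPE.  Assembly + numerals over the C-ENTRY line F-1…F-4b and landed bricks; the two NEW windows `10¹¹L⁶e ≤ 1`, `10¹⁶L⁵ε₀ ≤ 1` are DISPLAYED (heavier than S16ᴰ's `hWe`∕`hWε`:
the Cauchy route pays `1∕ρ = 10⁷ℓ²`); the family reading (`hC157` VERBATIM, `g L := 10¹¹L⁵`) is F-5b; nothing of EX, E′ or the crux is claimed; rung R3, not d = 4; YM gap NOT proved.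

References: T. Bałaban, CMP **98** (1985) 17–51 [Balaban1985Averaging] ((147)–(157) pp.40–42); CMP **102** (1985) 277–309 [Balaban1985Variational] ((2) p.278, (44)–(46) p.285,
(146) p.301).
-/

noncomputable section

open scoped BigOperators Matrix.Norms.L2Operator
open NormedSpace Metric Set Finset Filter Topology

namespace Summit.QuantumFields.YangMills.Theorems.Prop7CovKernel157Member

open Literature.MathematicalPhysics.QuantumFieldTheory.Balaban1983to89
open Literature.MathematicalPhysics.QuantumFieldTheory.Balaban1983to89.T3ContinuumYM3Torus
open T4Continuum BlockAveraging AveragingRT ExpMeanLog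
open MatrixLog (mlog)
open B7Prop1Explicit (expUnit val_expUnit)
open B10Eq27TorusAxialLog (unitsField toUField)
open T3RegularMinimiser (regThreshold regThreshold_pos)
open T3PrintedRegularMinimiser (RegPr)
open T3SectALandauChart (eta eta_pos bgUnits pos_of_regPr)
open T3LevelShift (bondShift)
open T3PrintedRegularOrbits (sites_eq)
open Summit.QuantumFields.YangMills.Theorems.Prop8Chart (emlAvgU emlIterU)
open Summit.QuantumFields.YangMills.Theorems.Prop7SymAvgTwSym (dbarCovU CmapTwS)
open Summit.QuantumFields.YangMills.Theorems.Prop7CovLogTower (exists_iterate exists_lin CmapTwS_apply_eq_iterate_sub_lin)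
open Summit.QuantumFields.YangMills.Theorems.Prop7CovLogTowerOfRegPr (succ_le_height hwinr_of_regPr differentiableAt_phiCov_zero_of_regPr)
open Summit.QuantumFields.YangMills.Theorems.Prop7CcolOf157Entry (differentiableAt_CmapTwS)
open Summit.QuantumFields.YangMills.Theorems.Prop7TwistedOneStepDefectOfRegPr (member_rows level_read_le)
open Summit.QuantumFields.YangMills.Theorems.Prop7CovKernelTowerAssembly (hasDerivAt_iterate_kernel_bound_of_plaqSmall)
open B7Prop4GeneralInduction (geom_sum_le_two)

/-! ## §1 Real-number lemmas -/

/-- `Σ_{l<J} Lˡ ≤ L^J / 2` for `3 ≤ L`. [folklore] -/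
theorem sum_pow_le_half {L : ℝ} (hL : 3 ≤ L) : ∀ J : ℕ, ∑ l ∈ Finset.range J, L ^ l ≤ L ^ J / 2 := by
  intro J
  induction J with
  | zero => simp
  | succ J ih =>
    rw [Finset.sum_range_succ, pow_succ]
    have : (0 : ℝ) ≤ L ^ J := by positivity
    nlinarith

/-- `s₀(l) ≤ 2700ε₀` from the level read `Lˡs_B ≤ 18ε₀∕L` (`ℓ = 5L`). [cite: Balaban1985Variational, (146) p.301] -/
theorem s0_member_le {Lr ℓr a₀ ε₀ : ℝ} {d l : ℕ} (hL : 0 < Lr) (hℓr : ℓr = 5 * Lr)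
    (hp : Lr ^ l * (2 * ((d : ℝ) * (3 * Lr ^ (l + 1) - 1)) * a₀) ≤ 18 * ε₀ / Lr) :
    30 * ℓr * Lr ^ l * (2 * ((d : ℝ) * (3 * Lr ^ (l + 1) - 1)) * a₀) ≤ 2700 * ε₀ := by
  subst hℓr
  have := mul_le_mul_of_nonneg_left hp (by positivity : (0 : ℝ) ≤ 30 * (5 * Lr))
  have e : 30 * (5 * Lr) * (18 * ε₀ / Lr) = 2700 * ε₀ := by field_simp; ring
  calc 30 * (5 * Lr) * Lr ^ l * (2 * ((d : ℝ) * (3 * Lr ^ (l + 1) - 1)) * a₀)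
      = 30 * (5 * Lr) * (Lr ^ l * (2 * ((d : ℝ) * (3 * Lr ^ (l + 1) - 1)) * a₀)) := by ring
    _ ≤ 2700 * ε₀ := by linarith

/-- `c_R(l) ≤ 2592·10¹¹·L³ε₀` at `ρ = (10⁷ℓ²)⁻¹`. [cite: Balaban1985Averaging, (139) p.39] -/
theorem cR_member_le {Lr ℓr ρ ε₀ s : ℝ} (hL : 0 < Lr) (hℓr : ℓr = 5 * Lr) (hρ : ρ = (10000000 * ℓr ^ 2)⁻¹) (hs : s ≤ 2700 * ε₀) :
    16 * (12 * Lr * ρ) / ρ ^ 2 * (2 * s) ≤ 2592 * 10 ^ 11 * Lr ^ 3 * ε₀ := by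
  subst hℓr; subst hρ
  have e : 16 * (12 * Lr * (10000000 * (5 * Lr) ^ 2)⁻¹) / ((10000000 * (5 * Lr) ^ 2)⁻¹) ^ 2 * (2 * s) = 96000000000 * Lr ^ 3 * s := by
    field_simp; ring
  rw [e]
  nlinarith [pow_pos hL 3]

/-- `4s₀ < ρ` under `10¹⁶L⁵ε₀ ≤ 1`. [cite: Balaban1985Averaging, (127) p.36] -/
theorem rho_member_window {Lr ℓr ρ ε₀ s : ℝ} (hL : 3 ≤ Lr) (hℓr : ℓr = 5 * Lr) (hρ : ρ = (10000000 * ℓr ^ 2)⁻¹) (hε₀ : 0 ≤ ε₀)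
    (hW : 10 ^ 16 * Lr ^ 5 * ε₀ ≤ 1) (hs : s ≤ 2700 * ε₀) : 4 * s < ρ := by
  subst hℓr; subst hρ
  have hL0 : 0 < Lr := by linarith
  rw [inv_eq_one_div, lt_div_iff₀ (by positivity)]
  have h9 : 9 ≤ Lr ^ 2 := by nlinarith
  have h27 : 27 ≤ Lr ^ 3 := by nlinarith [h9, hL0]
  have h2e : 0 ≤ Lr ^ 2 * ε₀ := mul_nonneg (pow_nonneg hL0.le 2) hε₀
  have h1 : Lr ^ 2 * ε₀ * 27 ≤ Lr ^ 5 * ε₀ := by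
    calc Lr ^ 2 * ε₀ * 27 ≤ Lr ^ 2 * ε₀ * Lr ^ 3 := mul_le_mul_of_nonneg_left h27 h2e
      _ = Lr ^ 5 * ε₀ := by ring
  nlinarith [pow_nonneg hL0.le 2, h2e]

/-- the F-1 window `4gθ ≤ 1` under `10¹⁶L⁵ε₀ ≤ 1` (d = 3). [cite: Balaban1985Averaging, (143) p.39] -/
theorem hg_member {Lr ε₀ κ : ℝ} {d : ℕ} (hd : d = 3) (hL : 3 ≤ Lr) (hW : 10 ^ 16 * Lr ^ 5 * ε₀ ≤ 1)
    (hκ : κ ≤ 2592 * 10 ^ 11 * Lr ^ 3 * ε₀) :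
    4 * (2 * (d : ℝ) * κ * Lr ^ (d + 1)) * (Lr ^ 2)⁻¹ ≤ 1 := by
  subst hd
  have hL0 : 0 < Lr := by linarith
  have e : 4 * (2 * ((3 : ℕ) : ℝ) * κ * Lr ^ (3 + 1)) * (Lr ^ 2)⁻¹ = 24 * κ * Lr ^ 2 := by push_cast; field_simp; ring
  rw [e]
  nlinarith [pow_nonneg hL0.le 2]

/-- `Σ c_R(l) ≤ L∕4` under `10¹⁶L⁵ε₀ ≤ 1`. [cite: Balaban1985Averaging, (143) p.39] -/
theorem hsumR_member {Lr ε₀ Sc : ℝ} (hL : 3 ≤ Lr) (hε₀ : 0 ≤ ε₀) (hW : 10 ^ 16 * Lr ^ 5 * ε₀ ≤ 1) (hSc : Sc ≤ (2592 * 10 ^ 11 * Lr ^ 3 * ε₀) * 2) :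
    Sc ≤ Lr / 4 := by
  have hL0 : 0 < Lr := by linarith
  have h9 : 9 ≤ Lr ^ 2 := by nlinarith
  have : Lr ^ 3 * ε₀ * 9 ≤ Lr ^ 5 * ε₀ := by nlinarith [pow_nonneg hL0.le 3, mul_nonneg (pow_nonneg hL0.le 3) hε₀]
  nlinarith

/-- `Σ D(l,R)·2dLᵈ·2Lˡ‖B‖ ≤ L∕4` under `10¹¹L⁶e ≤ 1`. [cite: Balaban1985Averaging, (131) p.37] -/
theorem hsumD_member {Lr e x SD : ℝ} (hL : 3 ≤ Lr) (hW : 10 ^ 11 * Lr ^ 6 * e ≤ 1) (hx : x ≤ e)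
    (hSD : SD ≤ 10 ^ 9 * Lr ^ 4 * Lr ^ 3 * (2 * x) * (1 / 2)) : SD ≤ Lr / 4 := by
  have hL0 : 0 < Lr := by linarith
  nlinarith [pow_nonneg hL0.le 6, pow_nonneg hL0.le 7]

/-- `8L^J‖B‖ ≤ R = (30000L)⁻¹` under `10¹¹L⁶e ≤ 1`. [cite: Balaban1985Averaging, (131) p.37] -/
theorem hB8_member {Lr e nb : ℝ} {J : ℕ} (hL : 3 ≤ Lr) (he : 0 ≤ e) (hW : 10 ^ 11 * Lr ^ 6 * e ≤ 1) (hnb : 0 ≤ nb) (hx : Lr ^ J * nb ≤ e) :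
    8 * Lr ^ J * nb ≤ (30000 * Lr)⁻¹ := by
  have hL0 : 0 < Lr := by linarith
  have hx0 : 0 ≤ Lr ^ J * nb := by positivity
  rw [inv_eq_one_div, le_div_iff₀ (by positivity)]
  have h243 : 243 ≤ Lr ^ 5 := by have := pow_le_pow_left₀ (by norm_num : (0:ℝ) ≤ 3) hL 5; norm_num at this; linarith
  have : Lr * e * 243 ≤ Lr ^ 6 * e := by nlinarith [mul_nonneg hL0.le he]
  nlinarith [mul_nonneg hL0.le he, mul_nonneg hL0.le hx0]

/-- the kernel window `θ + δ′ < 1` and the final constant `≤ 10¹¹L⁵·(L^J)⁻¹` (d = 3: `L·λ = L⁻¹`). [cite: Balaban1985Averaging, (155)–(157) pp.41–42] -/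
theorem kernel_member {Lr ε₀ e κ G nb nδ : ℝ} {d J : ℕ} (hd : d = 3) (hL : 3 ≤ Lr) (hε₀ : 0 ≤ ε₀) (he : 0 ≤ e)
    (hWε : 10 ^ 16 * Lr ^ 5 * ε₀ ≤ 1) (hWe : 10 ^ 11 * Lr ^ 6 * e ≤ 1)
    (hκ0 : 0 ≤ κ) (hκ : κ ≤ 2592 * 10 ^ 11 * Lr ^ 3 * ε₀) (hG0 : 0 ≤ G) (hG : 480 * G / 64 ≤ 10 ^ 9 * Lr ^ 4)
    (hnb : 0 ≤ nb) (hnδ : 0 ≤ nδ) (hx : Lr ^ J * nb ≤ e) :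
    (2 * (Lr * (Lr ^ d)⁻¹) + κ) / (Lr * (Lr * (Lr ^ d)⁻¹)) + (G * (2 * (d : ℝ)) / (Lr * (Lr * (Lr ^ d)⁻¹))) * (2 * Lr ^ J * nb) < 1 ∧
    (G * (2 * (d : ℝ)) / (Lr * (Lr * (Lr ^ d)⁻¹))) /
        (1 - (2 * (Lr * (Lr ^ d)⁻¹) + κ) / (Lr * (Lr * (Lr ^ d)⁻¹)) - (G * (2 * (d : ℝ)) / (Lr * (Lr * (Lr ^ d)⁻¹))) * (2 * Lr ^ J * nb)) *
        (2 * Lr ^ J * nb) * (2 * (Lr * (Lr ^ d)⁻¹) ^ J * nδ) ≤ 10 ^ 11 * Lr ^ 5 * (Lr ^ J)⁻¹ * nb * nδ := by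
  subst hd
  have hL0 : 0 < Lr := by linarith
  have hLne : Lr ≠ 0 := hL0.ne'
  set x : ℝ := Lr ^ J * nb with hxdef
  have hx0 : 0 ≤ x := by positivity
  have hθ : (2 * (Lr * (Lr ^ 3)⁻¹) + κ) / (Lr * (Lr * (Lr ^ 3)⁻¹)) = 2 / Lr + κ * Lr := by field_simp
  have hA : G * (2 * ((3 : ℕ) : ℝ)) / (Lr * (Lr * (Lr ^ 3)⁻¹)) = 6 * G * Lr := by push_cast; field_simp; ring
  have hxx : 2 * Lr ^ J * nb = 2 * x := by rw [hxdef]; ring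
  rw [hθ, hA, hxx]
  have h2L : 2 / Lr ≤ 2 / 3 := div_le_div_of_nonneg_left (by norm_num) (by norm_num) hL
  have hκL : κ * Lr ≤ 3 / 100 := by
    have h1 : κ * Lr ≤ 2592 * 10 ^ 11 * Lr ^ 4 * ε₀ := by nlinarith
    have h2 : Lr ^ 4 * ε₀ * 3 ≤ Lr ^ 5 * ε₀ := by nlinarith [pow_nonneg hL0.le 4, mul_nonneg (pow_nonneg hL0.le 4) hε₀]
    nlinarith
  have hGb : G ≤ 10 ^ 9 * Lr ^ 4 * 64 / 480 := by
    rw [le_div_iff₀ (by norm_num)]; linarith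
  have hδ : 6 * G * Lr * (2 * x) ≤ 1 / 50 := by
    have h1 : 6 * G * Lr * (2 * x) ≤ 12 * (10 ^ 9 * Lr ^ 4 * 64 / 480) * Lr * e := by
      have := mul_le_mul hGb hx hx0 (by positivity)
      nlinarith [mul_nonneg (mul_nonneg hG0 hL0.le) hx0, mul_nonneg hG0 hx0]
    have h2 : Lr ^ 5 * e * 3 ≤ Lr ^ 6 * e := by nlinarith [pow_nonneg hL0.le 5, mul_nonneg (pow_nonneg hL0.le 5) he]
    nlinarith
  refine ⟨by linarith, ?_⟩
  have hden : 1 / 4 ≤ 1 - (2 / Lr + κ * Lr) - 6 * G * Lr * (2 * x) := by linarith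
  have hA0 : 0 ≤ 6 * G * Lr := by positivity
  have hfrac : 6 * G * Lr / (1 - (2 / Lr + κ * Lr) - 6 * G * Lr * (2 * x)) ≤ 4 * (6 * G * Lr) := by
    rw [div_le_iff₀ (by linarith)]
    nlinarith
  have hfrac0 : 0 ≤ 6 * G * Lr / (1 - (2 / Lr + κ * Lr) - 6 * G * Lr * (2 * x)) := div_nonneg hA0 (by linarith)
  -- `(L·L⁻³)^J = L^J·(L^J)⁻¹·(L^J)⁻¹`: we only need `x·(L L⁻³)^J·L^J = x·(L^J)⁻¹·…`; write `(Lr * (Lr^3)⁻¹)^J * Lr^J * Lr^J = (Lr^J)⁻¹ * ...`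
  have hlam : (Lr * (Lr ^ 3)⁻¹) ^ J = (Lr ^ J)⁻¹ * (Lr ^ J)⁻¹ := by
    rw [mul_pow, inv_pow, ← pow_mul]
    have : Lr ^ (3 * J) = Lr ^ J * Lr ^ J * Lr ^ J := by rw [← pow_add, ← pow_add]; ring_nf
    rw [this]; field_simp
  have hLJ : 0 < Lr ^ J := by positivity
  -- the product
  have hkey : 6 * G * Lr / (1 - (2 / Lr + κ * Lr) - 6 * G * Lr * (2 * x)) * (2 * x) * (2 * (Lr * (Lr ^ 3)⁻¹) ^ J * nδ)
      = (6 * G * Lr / (1 - (2 / Lr + κ * Lr) - 6 * G * Lr * (2 * x))) * 4 * ((Lr ^ J)⁻¹ * nb * nδ) := by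
    rw [hlam, hxdef]; field_simp; ring
  rw [hkey]
  have hrest0 : 0 ≤ (Lr ^ J)⁻¹ * nb * nδ := by positivity
  calc 6 * G * Lr / (1 - (2 / Lr + κ * Lr) - 6 * G * Lr * (2 * x)) * 4 * ((Lr ^ J)⁻¹ * nb * nδ)
      ≤ 4 * (6 * G * Lr) * 4 * ((Lr ^ J)⁻¹ * nb * nδ) := by gcongr
    _ = 96 * G * Lr * ((Lr ^ J)⁻¹ * nb * nδ) := by ring
    _ ≤ 96 * (10 ^ 9 * Lr ^ 4 * 64 / 480) * Lr * ((Lr ^ J)⁻¹ * nb * nδ) := by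
        have := mul_le_mul_of_nonneg_right hGb (by positivity : 0 ≤ 96 * Lr * ((Lr ^ J)⁻¹ * nb * nδ))
        nlinarith
    _ ≤ 10 ^ 11 * Lr ^ 5 * (Lr ^ J)⁻¹ * nb * nδ := by nlinarith [pow_nonneg hL0.le 5, mul_nonneg (pow_nonneg hL0.le 5) hrest0]


/-! ## §2 The member: Prop. 5 (157) for the symmetric twisted chart at a printed-regular background -/

section Member

variable (F : T3Family) {n K : ℕ}

/-- ★★★ **[Balaban1985Averaging] PROP. 5 (157) FOR `C^{twS}(U₀)` AT `U₀ ∈ 𝔘_k(ε₀)`, AT THE MEMBER**: `n < K`, windows `10⁹L²e ≤ 1`, `10¹²L³ε₀ ≤ 1`, `10¹¹L⁶e ≤ 1`, `10¹⁶L⁵ε₀ ≤ 1`;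
for `‖B‖ < e·η`, a direction `δ` vanishing off one fine bond, and every coarse bond `c`:
**`‖(fderiv ℂ (C^{twS}(U₀)) B δ)(c)‖ ≤ 10¹¹·L⁵·(L^{K−n})⁻¹·‖B‖·‖δ‖`** — the (157)-twˢ entry row of the EX display (`g L := 10¹¹L⁵`), by the C-ENTRY line F-1…F-4b at ★px15's member budgets.
[cite: Balaban1985Averaging, (147)-(157) pp.40-42; Balaban1985Variational, (2) p.278, (146) p.301] -/
theorem norm_fderiv_CmapTwS_apply_le_of_regPr (hnK : n < K) {ε₀ e : ℝ} (hε₀ : 0 < ε₀) (he : 0 < e)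
    (hWe : 10 ^ 9 * (F.L : ℝ) ^ 2 * e ≤ 1) (hWε : 10 ^ 12 * (F.L : ℝ) ^ 3 * ε₀ ≤ 1)
    (hWe' : 10 ^ 11 * (F.L : ℝ) ^ 6 * e ≤ 1) (hWε' : 10 ^ 16 * (F.L : ℝ) ^ 5 * ε₀ ≤ 1)
    (U₀ : GaugeField (F.P K) 0 (Matrix.specialUnitaryGroup (Fin 2) ℂ)) (hreg : RegPr F n K ε₀ U₀)
    (B : PBond (F.P K) 0 → Matrix (Fin 2) (Fin 2) ℂ) (hB : ‖B‖ < e * eta F n K)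
    (b₀ : PBond (F.P K) 0) (δ : PBond (F.P K) 0 → Matrix (Fin 2) (Fin 2) ℂ) (hδ : ∀ b, b ≠ b₀ → δ b = 0) (c : PBond (F.P n) 0) :
    ‖fderiv ℂ (CmapTwS F n K hnK.le U₀) B δ c‖ ≤ 10 ^ 11 * (F.L : ℝ) ^ 5 * ((F.L : ℝ) ^ (K - n))⁻¹ * ‖B‖ * ‖δ‖ := by
  classical
  -- numerals of the member (all in the letters of `F.P K`; `(F.P K).L = F.L`, `(F.P K).d = 3` definitionally)
  have hL3n : 3 ≤ (F.P K).L := by show 3 ≤ F.L; obtain ⟨a, ha⟩ := F.hL.1; have := F.hL.2; omega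
  have hL3 : (3 : ℝ) ≤ ((F.P K).L : ℝ) := by exact_mod_cast hL3n
  have hL1 : (1 : ℝ) ≤ ((F.P K).L : ℝ) := by linarith
  have hL0 : (0 : ℝ) < ((F.P K).L : ℝ) := by linarith
  have hd : (F.P K).d = 3 := T3Family.P_d F K
  have hℓr : ((((F.P K).d + 2) * (F.P K).L : ℕ) : ℝ) = 5 * ((F.P K).L : ℝ) := by rw [hd]; push_cast; ring
  have hWe'P : 10 ^ 11 * ((F.P K).L : ℝ) ^ 6 * e ≤ 1 := hWe'
  have hWε'P : 10 ^ 16 * ((F.P K).L : ℝ) ^ 5 * ε₀ ≤ 1 := hWε'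
  set J : ℕ := K - n with hJdef
  have hJ1 : 1 ≤ J := by omega
  have hJm1 : J - 1 < J := by omega
  have hJ : J + 1 ≤ (F.P K).m + (F.P K).K := by show K - n + 1 ≤ F.m + K; have := F.hm; omega
  have ha₀ : 0 < regThreshold F n K ε₀ := regThreshold_pos F hε₀
  have hU := hreg.plaqSmall
  set ρ : ℝ := (10000000 * ((((F.P K).d + 2) * (F.P K).L : ℕ) : ℝ) ^ 2)⁻¹ with hρ
  have hρ0 : 0 < ρ := by rw [hρ]; positivity
  have hbudget : 10000000 * ((((F.P K).d + 2) * (F.P K).L : ℕ) : ℝ) ^ 2 * ρ ≤ 1 := by rw [hρ, mul_inv_cancel₀ (by positivity)]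
  set R : ℝ := (30000 * (F.L : ℝ))⁻¹ with hRdef
  have hR : 0 < R := by rw [hRdef]; positivity
  -- ★px15's rows at every level `l < J`
  have hrows : ∀ l, l < J → l + 2 ≤ (F.P K).m + (F.P K).K ∧
      6400 * ((((F.P K).d + 2) * (F.P K).L : ℕ) : ℝ) ^ 2 * ((F.P K).L : ℝ) ^ l * (2 * (((F.P K).d : ℝ) * (3 * ((F.P K).L : ℝ) ^ (l + 1) - 1)) * regThreshold F n K ε₀) ≤ 1 ∧
      1000 * ((((F.P K).d + 2) * (F.P K).L : ℕ) : ℝ) * (2 * (30 * ((((F.P K).d + 2) * (F.P K).L : ℕ) : ℝ) * ((F.P K).L : ℝ) ^ l * (2 * (((F.P K).d : ℝ) * (3 * ((F.P K).L : ℝ) ^ (l + 1) - 1)) * regThreshold F n K ε₀)) + 3 * R) ≤ 1 ∧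
      (80 * (((F.P K).L : ℝ) * (3 * R) + 22100 * ((((F.P K).d + 2) * (F.P K).L : ℕ) : ℝ) ^ 2 * ((30 * ((((F.P K).d + 2) * (F.P K).L : ℕ) : ℝ) * ((F.P K).L : ℝ) ^ l * (2 * (((F.P K).d : ℝ) * (3 * ((F.P K).L : ℝ) ^ (l + 1) - 1)) * regThreshold F n K ε₀)) + ((30 * ((((F.P K).d + 2) * (F.P K).L : ℕ) : ℝ) * ((F.P K).L : ℝ) ^ l * (2 * (((F.P K).d : ℝ) * (3 * ((F.P K).L : ℝ) ^ (l + 1) - 1)) * regThreshold F n K ε₀)) + 3 * R)) ^ 2) / R ^ 2) * (2 * ((F.P K).d : ℝ)) ≤ 10 ^ 9 * (F.L : ℝ) ^ 4 := by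
    intro l hl
    obtain ⟨hl2, -, -, -, hbud₀, hwin, hC⟩ := member_rows (F := F) (n := n) (K := K) (by linarith) hreg (show l + 1 ≤ K - n by omega)
      (s := 0) (by simp)
    exact ⟨hl2, hbud₀, hwin, hC⟩
  -- the leak letters
  have hs0 : ∀ l, l < J → (30 * ((((F.P K).d + 2) * (F.P K).L : ℕ) : ℝ) * ((F.P K).L : ℝ) ^ l * (2 * (((F.P K).d : ℝ) * (3 * ((F.P K).L : ℝ) ^ (l + 1) - 1)) * regThreshold F n K ε₀)) ≤ 2700 * ε₀ := by
    intro l hl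
    refine s0_member_le hL0 hℓr ?_
    show ((F.P K).L : ℝ) ^ l * (2 * (((F.P K).d : ℝ) * (3 * ((F.P K).L : ℝ) ^ (l + 1) - 1)) * regThreshold F n K ε₀) ≤ 18 * ε₀ / (F.L : ℝ)
    rw [hd]
    unfold regThreshold
    push_cast
    exact level_read_le hL1 hε₀.le (show l + 1 ≤ K - n by omega)
  have hs0nn : ∀ l : ℕ, 0 ≤ (30 * ((((F.P K).d + 2) * (F.P K).L : ℕ) : ℝ) * ((F.P K).L : ℝ) ^ l * (2 * (((F.P K).d : ℝ) * (3 * ((F.P K).L : ℝ) ^ (l + 1) - 1)) * regThreshold F n K ε₀)) := by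
    intro l
    have h3 : (0 : ℝ) ≤ 3 * ((F.P K).L : ℝ) ^ (l + 1) - 1 := by linarith [one_le_pow₀ (M₀ := ℝ) (n := l + 1) hL1]
    have := ha₀.le
    positivity
  have hκ : ∀ l, l < J → (16 * (12 * ((F.P K).L : ℝ) * ρ) / ρ ^ 2 * (2 * (30 * ((((F.P K).d + 2) * (F.P K).L : ℕ) : ℝ) * ((F.P K).L : ℝ) ^ l * (2 * (((F.P K).d : ℝ) * (3 * ((F.P K).L : ℝ) ^ (l + 1) - 1)) * regThreshold F n K ε₀)))) ≤ 2592 * 10 ^ 11 * ((F.P K).L : ℝ) ^ 3 * ε₀ := fun l hl => cR_member_le hL0 hℓr hρ (hs0 l hl)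
  have hκ0 : ∀ l, 0 ≤ (16 * (12 * ((F.P K).L : ℝ) * ρ) / ρ ^ 2 * (2 * (30 * ((((F.P K).d + 2) * (F.P K).L : ℕ) : ℝ) * ((F.P K).L : ℝ) ^ l * (2 * (((F.P K).d : ℝ) * (3 * ((F.P K).L : ℝ) ^ (l + 1) - 1)) * regThreshold F n K ε₀)))) := fun l => by have := hs0nn l; positivity
  have hs₀ρ : ∀ l, l < J → 4 * (30 * ((((F.P K).d + 2) * (F.P K).L : ℕ) : ℝ) * ((F.P K).L : ℝ) ^ l * (2 * (((F.P K).d : ℝ) * (3 * ((F.P K).L : ℝ) ^ (l + 1) - 1)) * regThreshold F n K ε₀)) < ρ := fun l hl => rho_member_window hL3 hℓr hρ hε₀.le hWε'P (hs0 l hl)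
  -- the towers
  obtain ⟨Fm, hF0, hFs⟩ := exists_iterate (P := (F.P K)) (bgUnits F K U₀)
  obtain ⟨Lin, hLin0, hLins⟩ := exists_lin (P := (F.P K)) (bgUnits F K U₀)
  -- `L^J‖B‖ ≤ e`
  have hηJ : ((F.P K).L : ℝ) ^ J * eta F n K = 1 := by
    show (F.L : ℝ) ^ J * eta F n K = 1
    unfold eta; rw [← hJdef, ← mul_pow, mul_inv_cancel₀ (by exact_mod_cast (show F.L ≠ 0 by have := F.hL.2; omega)), one_pow]
  have hx : ((F.P K).L : ℝ) ^ J * ‖B‖ ≤ e := by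
    calc ((F.P K).L : ℝ) ^ J * ‖B‖ ≤ ((F.P K).L : ℝ) ^ J * (e * eta F n K) := mul_le_mul_of_nonneg_left hB.le (by positivity)
      _ = e * (((F.P K).L : ℝ) ^ J * eta F n K) := by ring
      _ = e := by rw [hηJ, mul_one]
  -- F-4b's numeric hypotheses at the member
  have hB8 : 8 * ((F.P K).L : ℝ) ^ J * ‖B‖ ≤ R := hB8_member hL3 he.le hWe'P (norm_nonneg B) hx
  have hsumR : ∑ l ∈ Finset.range J, (16 * (12 * ((F.P K).L : ℝ) * ρ) / ρ ^ 2 * (2 * (30 * ((((F.P K).d + 2) * (F.P K).L : ℕ) : ℝ) * ((F.P K).L : ℝ) ^ l * (2 * (((F.P K).d : ℝ) * (3 * ((F.P K).L : ℝ) ^ (l + 1) - 1)) * regThreshold F n K ε₀)))) ≤ ((F.P K).L : ℝ) / 4 := by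
    set r : ℝ := (((F.P K).L : ℝ) ^ 2)⁻¹ with hr
    have hr0 : 0 ≤ r := by positivity
    have hr2 : r ≤ 1 / 2 := by
      rw [hr, inv_eq_one_div]; exact div_le_div_of_nonneg_left (by norm_num) (by norm_num) (by nlinarith)
    have hterm : ∀ l ∈ Finset.range J, (16 * (12 * ((F.P K).L : ℝ) * ρ) / ρ ^ 2 * (2 * (30 * ((((F.P K).d + 2) * (F.P K).L : ℕ) : ℝ) * ((F.P K).L : ℝ) ^ l * (2 * (((F.P K).d : ℝ) * (3 * ((F.P K).L : ℝ) ^ (l + 1) - 1)) * regThreshold F n K ε₀)))) ≤ (2592 * 10 ^ 11 * ((F.P K).L : ℝ) ^ 3 * ε₀) * r ^ (J - 1 - l) := by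
      intro l hl
      rw [Finset.mem_range] at hl
      have hgeo := Prop7CovLinearTowerProfile.s0_mul_pow_le (P := (F.P K)) hL1 ha₀.le l (J - 1 - l)
      rw [show l + (J - 1 - l) = J - 1 by omega] at hgeo
      have hX : (0 : ℝ) < (((F.P K).L : ℝ) ^ 2) ^ (J - 1 - l) := by positivity
      have hcmp : (30 * ((((F.P K).d + 2) * (F.P K).L : ℕ) : ℝ) * ((F.P K).L : ℝ) ^ l * (2 * (((F.P K).d : ℝ) * (3 * ((F.P K).L : ℝ) ^ (l + 1) - 1)) * regThreshold F n K ε₀)) ≤ (30 * ((((F.P K).d + 2) * (F.P K).L : ℕ) : ℝ) * ((F.P K).L : ℝ) ^ (J - 1) * (2 * (((F.P K).d : ℝ) * (3 * ((F.P K).L : ℝ) ^ ((J - 1) + 1) - 1)) * regThreshold F n K ε₀)) * r ^ (J - 1 - l) := by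
        rw [hr, inv_pow, ← div_eq_mul_inv, le_div_iff₀ hX]; exact hgeo
      have hc0 : 0 ≤ 16 * (12 * ((F.P K).L : ℝ) * ρ) / ρ ^ 2 * 2 := by positivity
      have hpow0 : 0 ≤ r ^ (J - 1 - l) := by positivity
      calc (16 * (12 * ((F.P K).L : ℝ) * ρ) / ρ ^ 2 * (2 * (30 * ((((F.P K).d + 2) * (F.P K).L : ℕ) : ℝ) * ((F.P K).L : ℝ) ^ l * (2 * (((F.P K).d : ℝ) * (3 * ((F.P K).L : ℝ) ^ (l + 1) - 1)) * regThreshold F n K ε₀)))) = 16 * (12 * ((F.P K).L : ℝ) * ρ) / ρ ^ 2 * 2 * (30 * ((((F.P K).d + 2) * (F.P K).L : ℕ) : ℝ) * ((F.P K).L : ℝ) ^ l * (2 * (((F.P K).d : ℝ) * (3 * ((F.P K).L : ℝ) ^ (l + 1) - 1)) * regThreshold F n K ε₀)) := by ring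
        _ ≤ 16 * (12 * ((F.P K).L : ℝ) * ρ) / ρ ^ 2 * 2 * ((30 * ((((F.P K).d + 2) * (F.P K).L : ℕ) : ℝ) * ((F.P K).L : ℝ) ^ (J - 1) * (2 * (((F.P K).d : ℝ) * (3 * ((F.P K).L : ℝ) ^ ((J - 1) + 1) - 1)) * regThreshold F n K ε₀)) * r ^ (J - 1 - l)) := mul_le_mul_of_nonneg_left hcmp hc0
        _ = (16 * (12 * ((F.P K).L : ℝ) * ρ) / ρ ^ 2 * (2 * (30 * ((((F.P K).d + 2) * (F.P K).L : ℕ) : ℝ) * ((F.P K).L : ℝ) ^ (J - 1) * (2 * (((F.P K).d : ℝ) * (3 * ((F.P K).L : ℝ) ^ ((J - 1) + 1) - 1)) * regThreshold F n K ε₀)))) * r ^ (J - 1 - l) := by ring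
        _ ≤ (2592 * 10 ^ 11 * ((F.P K).L : ℝ) ^ 3 * ε₀) * r ^ (J - 1 - l) := mul_le_mul_of_nonneg_right (hκ (J - 1) hJm1) hpow0
    have hsum1 := Finset.sum_le_sum hterm
    have hsum2 : ∑ l ∈ Finset.range J, (2592 * 10 ^ 11 * ((F.P K).L : ℝ) ^ 3 * ε₀) * r ^ (J - 1 - l) =
        (2592 * 10 ^ 11 * ((F.P K).L : ℝ) ^ 3 * ε₀) * ∑ l ∈ Finset.range J, r ^ l := by
      rw [Finset.mul_sum]
      exact Finset.sum_range_reflect (fun l => (2592 * 10 ^ 11 * ((F.P K).L : ℝ) ^ 3 * ε₀) * r ^ l) J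
    rw [hsum2] at hsum1
    have h2 := geom_sum_le_two hr0 hr2 J
    have hκnn : 0 ≤ 2592 * 10 ^ 11 * ((F.P K).L : ℝ) ^ 3 * ε₀ := by have := hε₀.le; positivity
    exact hsumR_member hL3 hε₀.le hWε'P (hsum1.trans (mul_le_mul_of_nonneg_left h2 hκnn))
  have hsumD : ∑ l ∈ Finset.range J, (80 * (((F.P K).L : ℝ) * (3 * R) + 22100 * ((((F.P K).d + 2) * (F.P K).L : ℕ) : ℝ) ^ 2 * ((30 * ((((F.P K).d + 2) * (F.P K).L : ℕ) : ℝ) * ((F.P K).L : ℝ) ^ l * (2 * (((F.P K).d : ℝ) * (3 * ((F.P K).L : ℝ) ^ (l + 1) - 1)) * regThreshold F n K ε₀)) + ((30 * ((((F.P K).d + 2) * (F.P K).L : ℕ) : ℝ) * ((F.P K).L : ℝ) ^ l * (2 * (((F.P K).d : ℝ) * (3 * ((F.P K).L : ℝ) ^ (l + 1) - 1)) * regThreshold F n K ε₀)) + 3 * R)) ^ 2) / R ^ 2) * (2 * (F.P K).d * ((F.P K).L : ℝ) ^ (F.P K).d) * (2 * ((F.P K).L : ℝ) ^ l * ‖B‖)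 ≤ ((F.P K).L : ℝ) / 4 := by
    have hterm : ∀ l ∈ Finset.range J, (80 * (((F.P K).L : ℝ) * (3 * R) + 22100 * ((((F.P K).d + 2) * (F.P K).L : ℕ) : ℝ) ^ 2 * ((30 * ((((F.P K).d + 2) * (F.P K).L : ℕ) : ℝ) * ((F.P K).L : ℝ) ^ l * (2 * (((F.P K).d : ℝ) * (3 * ((F.P K).L : ℝ) ^ (l + 1) - 1)) * regThreshold F n K ε₀)) + ((30 * ((((F.P K).d + 2) * (F.P K).L : ℕ) : ℝ) * ((F.P K).L : ℝ) ^ l * (2 * (((F.P K).d : ℝ) * (3 * ((F.P K).L : ℝ) ^ (l + 1) - 1)) * regThreshold F n K ε₀)) + 3 * R)) ^ 2) / R ^ 2) * (2 * (F.P K).d * ((F.P K).L : ℝ) ^ (F.P K).d) * (2 * ((F.P K).L : ℝ) ^ l * ‖B‖) ≤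
        (10 ^ 9 * ((F.P K).L : ℝ) ^ 4 * ((F.P K).L : ℝ) ^ 3 * (2 * ‖B‖)) * ((F.P K).L : ℝ) ^ l := by
      intro l hl
      rw [Finset.mem_range] at hl
      have hC : (80 * (((F.P K).L : ℝ) * (3 * R) + 22100 * ((((F.P K).d + 2) * (F.P K).L : ℕ) : ℝ) ^ 2 * ((30 * ((((F.P K).d + 2) * (F.P K).L : ℕ) : ℝ) * ((F.P K).L : ℝ) ^ l * (2 * (((F.P K).d : ℝ) * (3 * ((F.P K).L : ℝ) ^ (l + 1) - 1)) * regThreshold F n K ε₀)) + ((30 * ((((F.P K).d + 2) * (F.P K).L : ℕ) : ℝ) * ((F.P K).L : ℝ) ^ l * (2 * (((F.P K).d : ℝ) * (3 * ((F.P K).L : ℝ) ^ (l + 1) - 1)) * regThreshold F n K ε₀)) + 3 * R)) ^ 2) / R ^ 2) * (2 * ((F.P K).d : ℝ)) ≤ 10 ^ 9 * ((F.P K).L : ℝ) ^ 4 := (hrows l hl).2.2.2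
      have hB0 : 0 ≤ ((F.P K).L : ℝ) ^ (F.P K).d * (2 * ((F.P K).L : ℝ) ^ l * ‖B‖) := by positivity
      calc (80 * (((F.P K).L : ℝ) * (3 * R) + 22100 * ((((F.P K).d + 2) * (F.P K).L : ℕ) : ℝ) ^ 2 * ((30 * ((((F.P K).d + 2) * (F.P K).L : ℕ) : ℝ) * ((F.P K).L : ℝ) ^ l * (2 * (((F.P K).d : ℝ) * (3 * ((F.P K).L : ℝ) ^ (l + 1) - 1)) * regThreshold F n K ε₀)) + ((30 * ((((F.P K).d + 2) * (F.P K).L : ℕ) : ℝ) * ((F.P K).L : ℝ) ^ l * (2 * (((F.P K).d : ℝ) * (3 * ((F.P K).L : ℝ) ^ (l + 1) - 1)) * regThreshold F n K ε₀)) + 3 * R)) ^ 2) / R ^ 2) * (2 * (F.P K).d * ((F.P K).L : ℝ) ^ (F.P K).d) * (2 * ((F.P K).L : ℝ) ^ l * ‖B‖)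
          = ((80 * (((F.P K).L : ℝ) * (3 * R) + 22100 * ((((F.P K).d + 2) * (F.P K).L : ℕ) : ℝ) ^ 2 * ((30 * ((((F.P K).d + 2) * (F.P K).L : ℕ) : ℝ) * ((F.P K).L : ℝ) ^ l * (2 * (((F.P K).d : ℝ) * (3 * ((F.P K).L : ℝ) ^ (l + 1) - 1)) * regThreshold F n K ε₀)) + ((30 * ((((F.P K).d + 2) * (F.P K).L : ℕ) : ℝ) * ((F.P K).L : ℝ) ^ l * (2 * (((F.P K).d : ℝ) * (3 * ((F.P K).L : ℝ) ^ (l + 1) - 1)) * regThreshold F n K ε₀)) + 3 * R)) ^ 2) / R ^ 2) * (2 * ((F.P K).d : ℝ))) * (((F.P K).L : ℝ) ^ (F.P K).d * (2 * ((F.P K).L : ℝ) ^ l * ‖B‖)) := by push_cast; ring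
        _ ≤ (10 ^ 9 * ((F.P K).L : ℝ) ^ 4) * (((F.P K).L : ℝ) ^ (F.P K).d * (2 * ((F.P K).L : ℝ) ^ l * ‖B‖)) := mul_le_mul_of_nonneg_right hC hB0
        _ = (10 ^ 9 * ((F.P K).L : ℝ) ^ 4 * ((F.P K).L : ℝ) ^ 3 * (2 * ‖B‖)) * ((F.P K).L : ℝ) ^ l := by rw [hd]; ring
    have hsum := Finset.sum_le_sum hterm
    rw [← Finset.mul_sum] at hsum
    have hhalf := sum_pow_le_half hL3 J
    have hc0 : 0 ≤ 10 ^ 9 * ((F.P K).L : ℝ) ^ 4 * ((F.P K).L : ℝ) ^ 3 * (2 * ‖B‖) := by positivity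
    refine hsumD_member hL3 hWe'P hx (hsum.trans ?_)
    have := mul_le_mul_of_nonneg_left hhalf hc0
    refine this.trans (le_of_eq ?_)
    ring
  have hg : 4 * (2 * ((F.P K).d : ℝ) * (16 * (12 * ((F.P K).L : ℝ) * ρ) / ρ ^ 2 * (2 * (30 * ((((F.P K).d + 2) * (F.P K).L : ℕ) : ℝ) * ((F.P K).L : ℝ) ^ (J - 1) * (2 * (((F.P K).d : ℝ) * (3 * ((F.P K).L : ℝ) ^ ((J - 1) + 1) - 1)) * regThreshold F n K ε₀)))) * ((F.P K).L : ℝ) ^ ((F.P K).d + 1)) * (((F.P K).L : ℝ) ^ 2)⁻¹ ≤ 1 :=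
    hg_member hd hL3 hWε'P (hκ (J - 1) hJm1)
  have hG0 : 0 ≤ 64 * (((F.P K).L : ℝ) * (3 * R) + 22100 * ((((F.P K).d + 2) * (F.P K).L : ℕ) : ℝ) ^ 2 * ((30 * ((((F.P K).d + 2) * (F.P K).L : ℕ) : ℝ) * ((F.P K).L : ℝ) ^ (J - 1) * (2 * (((F.P K).d : ℝ) * (3 * ((F.P K).L : ℝ) ^ ((J - 1) + 1) - 1)) * regThreshold F n K ε₀)) + ((30 * ((((F.P K).d + 2) * (F.P K).L : ℕ) : ℝ) * ((F.P K).L : ℝ) ^ (J - 1) * (2 * (((F.P K).d : ℝ) * (3 * ((F.P K).L : ℝ) ^ ((J - 1) + 1) - 1)) * regThreshold F n K ε₀)) + 3 * R)) ^ 2) / R ^ 2 := by have := hs0nn (J - 1); positivity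
  have hGbound : 480 * (64 * (((F.P K).L : ℝ) * (3 * R) + 22100 * ((((F.P K).d + 2) * (F.P K).L : ℕ) : ℝ) ^ 2 * ((30 * ((((F.P K).d + 2) * (F.P K).L : ℕ) : ℝ) * ((F.P K).L : ℝ) ^ (J - 1) * (2 * (((F.P K).d : ℝ) * (3 * ((F.P K).L : ℝ) ^ ((J - 1) + 1) - 1)) * regThreshold F n K ε₀)) + ((30 * ((((F.P K).d + 2) * (F.P K).L : ℕ) : ℝ) * ((F.P K).L : ℝ) ^ (J - 1) * (2 * (((F.P K).d : ℝ) * (3 * ((F.P K).L : ℝ) ^ ((J - 1) + 1) - 1)) * regThreshold F n K ε₀)) + 3 * R)) ^ 2) / R ^ 2) / 64 ≤ 10 ^ 9 * ((F.P K).L : ℝ) ^ 4 := by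
    have hC := (hrows (J - 1) hJm1).2.2.2
    refine le_trans (le_of_eq ?_) hC
    rw [hd]; push_cast; ring
  have hKW := kernel_member (nδ := ‖δ‖) hd hL3 hε₀.le he.le hWε'P hWe'P (hκ0 (J - 1)) (hκ (J - 1) hJm1) hG0 hGbound (norm_nonneg B) (norm_nonneg δ) hx
  -- the kernel tower (F-4b)
  obtain ⟨vd, hder, hbd⟩ := hasDerivAt_iterate_kernel_bound_of_plaqSmall (P := (F.P K)) hL3n hJ U₀ ha₀ hU
    (fun l hl => (hrows l hl).2.1) hρ0 hbudget hs₀ρ hR (fun l hl => (hrows l hl).2.2.1) Fm hF0 hFs Lin hLin0 hLins B hB8 hsumR hsumD hg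
    (le_refl _) (le_refl _) hKW.1 b₀ δ hδ
  -- identification of `fderiv C^{twS}(B)[δ](c)` with the kernel at `ĉ`
  set ĉ := bondShift (sites_eq F n K hnK.le) c with hĉ
  have hwinr := hwinr_of_regPr F (n := n) (K := K) hε₀ he.le hWe hWε U₀ hreg
  have hdiff := fun m (hm : m < K - n) => differentiableAt_phiCov_zero_of_regPr F (n := n) (K := K) hε₀ (by linarith) U₀ hreg hm
  have hident : ∀ X : PBond (F.P K) 0 → Matrix (Fin 2) (Fin 2) ℂ, ‖X‖ < e * eta F n K → CmapTwS F n K hnK.le U₀ X c = (Fm J X - Lin J X) ĉ := fun X hX =>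
    CmapTwS_apply_eq_iterate_sub_lin F n K hnK.le U₀ Fm hF0 hFs Lin hLin0 hLins (mul_pos he (eta_pos F n K)) hwinr hdiff X hX c
  have hFd : DifferentiableAt ℂ (CmapTwS F n K hnK.le U₀) B := differentiableAt_CmapTwS F hnK.le hε₀ he hWe hWε U₀ hreg hB
  have hline : HasDerivAt (fun t : ℂ => B + t • δ) δ 0 := by
    have h := ((hasDerivAt_id (0 : ℂ)).smul_const δ).const_add B
    simpa using h
  have hFd' : HasFDerivAt (CmapTwS F n K hnK.le U₀) (fderiv ℂ (CmapTwS F n K hnK.le U₀) B) (B + (0 : ℂ) • δ) := by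
    rw [zero_smul, add_zero]; exact hFd.hasFDerivAt
  have hchain : HasDerivAt (fun t : ℂ => CmapTwS F n K hnK.le U₀ (B + t • δ)) (fderiv ℂ (CmapTwS F n K hnK.le U₀) B δ) 0 := by
    have h := hFd'.comp_hasDerivAt (0 : ℂ) hline
    exact h
  have hcompC : HasDerivAt (fun t : ℂ => CmapTwS F n K hnK.le U₀ (B + t • δ) c) (fderiv ℂ (CmapTwS F n K hnK.le U₀) B δ c) 0 :=
    (hasDerivAt_pi.mp hchain) c
  have hball : ∀ᶠ t : ℂ in 𝓝 0, ‖B + t • δ‖ < e * eta F n K := by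
    have hcont : Continuous fun t : ℂ => B + t • δ := continuous_const.add (continuous_id.smul continuous_const)
    have hopen : IsOpen {X : PBond (F.P K) 0 → Matrix (Fin 2) (Fin 2) ℂ | ‖X‖ < e * eta F n K} := isOpen_lt continuous_norm continuous_const
    have hmem : (fun t : ℂ => B + t • δ) 0 ∈ {X : PBond (F.P K) 0 → Matrix (Fin 2) (Fin 2) ℂ | ‖X‖ < e * eta F n K} := by
      show ‖B + (0 : ℂ) • δ‖ < e * eta F n K
      rw [zero_smul, add_zero]; exact hB
    exact hcont.continuousAt.preimage_mem_nhds (hopen.mem_nhds hmem)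
  have hev : (fun t : ℂ => Fm J (B + t • δ) ĉ - Lin J (B + t • δ) ĉ) =ᶠ[𝓝 0] fun t => CmapTwS F n K hnK.le U₀ (B + t • δ) c := by
    filter_upwards [hball] with t ht
    rw [hident _ ht, Pi.sub_apply]
  have hFmC : HasDerivAt (fun t : ℂ => Fm J (B + t • δ) ĉ) (vd ĉ) 0 := (hasDerivAt_pi.mp hder) ĉ
  have hLinC : HasDerivAt (fun t : ℂ => Lin J (B + t • δ) ĉ) (Lin J δ ĉ) 0 := by
    have hfun : (fun t : ℂ => Lin J (B + t • δ) ĉ) = fun t => Lin J B ĉ + t • Lin J δ ĉ := by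
      funext t; rw [map_add, map_smul, Pi.add_apply, Pi.smul_apply]
    rw [hfun]
    have h := ((hasDerivAt_id (0 : ℂ)).smul_const (Lin J δ ĉ)).const_add (Lin J B ĉ)
    simpa using h
  have hK : HasDerivAt (fun t : ℂ => CmapTwS F n K hnK.le U₀ (B + t • δ) c) (vd ĉ - Lin J δ ĉ) 0 :=
    (hFmC.sub hLinC).congr_of_eventuallyEq hev.symm
  have hEq : fderiv ℂ (CmapTwS F n K hnK.le U₀) B δ c = vd ĉ - Lin J δ ĉ := hcompC.unique hK
  rw [hEq]
  exact (hbd ĉ).trans hKW.2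

end Member

end Summit.QuantumFields.YangMills.Theorems.Prop7CovKernel157Member

end
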